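/-
Copyright (c) 2026 the pub-hodgecm-mathlib formalisation cell (harness21).  Prover seat hodgecm-mathlib-K2Liu-p14 (g3), Track B «K2-LIT»,
#184♮ = hLiu418 = `stmt-HodgeConjecture-24832`; Road I v3, S5-F3 lineage ∕ I4-conv (F′-fact), FILE D: the Euler product of the Klingen-fibre inner section ALONG A SPLITTING.
-/
import Summits.HodgeConjecture.HodgeConjecture.Theorems.K2LiuSiegelUnipotentEulerProduct   -- ★ Φ3c §1: `integral_mul_finprod_eq_mul_tprod`, `hasProd_integral_of_integrable_finprod`, `integrable_finprod_of_integrable_mul`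
import HarnessLib

/-!
# Crux `HLiu418`, I4-conv (F′-fact), FILE D — `K2LiuKlingenInnerSectionEuler`: THE EULER PRODUCT OF A FACTORIZABLE INTEGRAND ALONG AN ABSTRACT SPLITTING
# `∫_Q F dμ_Q = (∫_X F_T dμ_T) · ∏'_{v∉T} ∫ F_v dν_v` whenever `E : Q ≃ᵐ X × Πʳ_{v} [G_v, K_v]` pushes `μ_Q` to `μ_T ⊗ ∏'(ν_v; K_v)` and `F ∘ E⁻¹ = F_T ⊗ (⊗_v F_v)`

Cell `hodgecm-mathlib`, crux item hLiu418 = `stmt-HodgeConjecture-24832`; squad K2 ∕ K2Liu; LEAD F0P6-plan (g14); prover K2Liu-p14 (g3) (census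
`K2/K2Liu-p14/g3/CENSUS-I4conv-FprimeFact.K2Liu-p14-g3.md` 889e5ba8cd056cf7 §2 FILE D).  THEOREMS ONLY (no `def`, no instance, no notation, no named-fact hypothesis,
no `sorry`); lane `--supports stmt-HodgeConjecture-24832 --as helper` (count-neutral).

THE POINT.  ★ Φ3c `K2LiuSiegelUnipotentEulerProduct` proves the Euler product of a factorizable integrable function on `N_Δ(𝔸)` by (i) transporting along the NAMED
splitting `unipDeltaSplitAt S : N_Δ(𝔸) ≃ₜ* N_∞ × (Π_{v∈S} N_v × Πʳ_{v∉S} N_v)` (★ Φ3b pin `hmap`) and (ii) its GENERIC §1 `integral_mul_finprod_eq_mul_tprod` on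
`X × Πʳ i, [G i, K i]`.  Step (i) is written there for `N_Δ` only.  The inner section of term 2 of the Klingen constant term (★ F8∕F5-q: `F′_h(y) = ∫_{Y(𝔸) × 𝔸_L} f(Ψ(ξ)·Ψ(n_Q(q))·
Ψ(m_Q(1,j₂⁻¹y))·h) d(μ_Y ⊗ μ_T)`), the fibres of ★ (β0-1a)'s corner unfolding, and every later fibre integral need the SAME step (i) for OTHER carriers.  This file does step
(i) ONCE for an ABSTRACT measure space `(Q, μ_Q)` and an ABSTRACT measurable splitting `E : Q ≃ᵐ X × Πʳ i, [G i, K i]` with `μ_Q ∘ E⁻¹ = μ ⊗ ∏'(ν_i; K_i)` (binder `hmap` —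
for the Klingen fibre it is FILE D0 `K2LiuKlingenFibreHaarPinned`'s pin) and an integrand of shape (F) along `E` (binder `hF` — for the Klingen fibre it is ★ #31s
`IsFactorizableOff` of `f_s` read through the place components of `Ψ`, FILE B):
* §1 `integrable_comp_symm_of_map_eq` (integrability transports along `E`), `integral_eq_integral_comp_symm_of_map_eq` (`∫_Q F dμ_Q = ∫ F ∘ E⁻¹ d(μ ⊗ ∏'ν)`);
* §2 **`integral_eq_mul_tprod_of_map_eq`** — THE HEAD: `F ∈ L¹(μ_Q)`, `F(E⁻¹(x,y)) = g(x) · ∏ᶠ_i φ_i(y_i)`, `φ_i ≡ 1` on `K_i`, `ν_i(K_i) = 1` ⟹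
  `∫_Q F dμ_Q = (∫ g dμ) · ∏'_i ∫ φ_i dν_i` AND the tensor `(x,y) ↦ g(x)·∏ᶠ φ_i(y_i)` is `μ ⊗ ∏'ν`-integrable;
  **`hasProd_integral_of_map_eq`** — if moreover `g` is not a.e. zero, the Euler product `∏_i ∫ φ_i dν_i` CONVERGES (`HasProd`) to `∫ ∏ᶠ φ_i d∏'ν`
  (★ `integrable_finprod_of_integrable_mul` + ★ Tate 3.3.1 `hasProd_integral_of_integrable_finprod`) — so the product of the local constants `c_v(s) = ∫ F_v dν_v` of the
  Klingen fibre converges for free from the integrability of the global integrand (★ F4-2b under (H)), as the census promised;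
  `integral_eq_mul_tprod_of_map_eq'` — the same head with the splitting given as a `MeasurePreserving` measurable equivalence.
[CasselsFrohlichANT1967, Ch. XV (Tate) §3.3 Thm. 3.3.1], [BorelJacquet1979, §4.1], [Tan1999, §2], [MoeglinWaldspurger1995, II.1.7].
HONEST LABEL.  Count-neutral helper: `HC_CM` is proved only modulo the 7 printed citations (2 remaining named inputs: hLiu418 = `stmt-HodgeConjecture-24832`,
h413 = `stmt-HodgeConjecture-24833`) until rung 0 closes.
-/

set_option autoImplicit false
set_option linter.dupNamespace false -- the mandated namespace repeats `HodgeConjecture.HodgeConjecture`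

noncomputable section

open scoped RestrictedProduct ENNReal NNReal Topology
open MeasureTheory Measure Filter Set

namespace Summit.HodgeConjecture.HodgeConjecture.Cruxes.HLiu418.K2LiuKlingenInnerSectionEuler

open Literature.MeasureTheory.RestrictedProduct
open Summit.HodgeConjecture.HodgeConjecture.Cruxes.HLiu418.K2LiuSiegelUnipotentEulerProduct
  (integral_mul_finprod_eq_mul_tprod hasProd_integral_of_integrable_finprod integrable_finprod_of_integrable_mul)

variable {Q : Type} [MeasurableSpace Q] {X : Type} [MeasurableSpace X]
  {ι : Type} {G : ι → Type} [∀ i, MeasurableSpace (G i)] [Countable ι]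
  (K : ∀ i, Set (G i)) (ν : ∀ i, Measure (G i)) [∀ i, SigmaFinite (ν i)]

/-! ## §1 Transport of integrability and of the integral along the splitting -/

omit [Countable ι] [∀ i, SigmaFinite (ν i)] in
/-- **integrability transports along the splitting**: if `μ_Q ∘ E⁻¹ = μ'` then `F ∈ L¹(μ_Q) ↔ F ∘ E⁻¹ ∈ L¹(μ')` (Mathlib `MeasurePreserving.integrable_comp_emb`
for the measurable equivalence `E⁻¹`). [cite: BorelJacquet1979, §4.1] -/
theorem integrable_comp_symm_of_map_eq (μQ : Measure Q) (μ' : Measure (X × (Πʳ i, [G i, K i])))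
    (E : Q ≃ᵐ X × (Πʳ i, [G i, K i])) (hmap : Measure.map E μQ = μ') {F : Q → ℂ} :
    Integrable (fun z => F (E.symm z)) μ' ↔ Integrable F μQ := by
  have hE : MeasurePreserving E μQ μ' := ⟨E.measurable, hmap⟩
  have h := (hE.symm E).integrable_comp_emb E.symm.measurableEmbedding (g := F)
  refine ⟨fun hF => ?_, fun hF => h.2 hF⟩
  have h' := h.1 hF
  simpa only [Function.comp_def, MeasurableEquiv.symm_apply_apply] using h'

omit [Countable ι] [∀ i, SigmaFinite (ν i)] in
/-- **the integral transports along the splitting**: `∫_Q F dμ_Q = ∫ F(E⁻¹ z) dμ'(z)` when `μ_Q ∘ E⁻¹ = μ'` (Mathlib `integral_map_equiv`; no integrability needed).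
[cite: BorelJacquet1979, §4.1] -/
theorem integral_eq_integral_comp_symm_of_map_eq (μQ : Measure Q) (μ' : Measure (X × (Πʳ i, [G i, K i])))
    (E : Q ≃ᵐ X × (Πʳ i, [G i, K i])) (hmap : Measure.map E μQ = μ') (F : Q → ℂ) :
    ∫ q, F q ∂μQ = ∫ z, F (E.symm z) ∂μ' := by
  rw [← hmap, integral_map_equiv]
  exact integral_congr_ae (Eventually.of_forall fun q => by simp only [MeasurableEquiv.symm_apply_apply])

/-! ## §2 The Euler product along the splitting -/

/-- **THE EULER PRODUCT OF A FACTORIZABLE INTEGRAND ALONG AN ABSTRACT SPLITTING.**  `(Q, μ_Q)` a measure space, `E : Q ≃ᵐ X × Πʳ i, [G i, K i]` a measurable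
splitting with `μ_Q ∘ E⁻¹ = μ ⊗ ∏'(ν_i; K_i)` (`hmap`; `ν_i(K_i) = 1`, `K_i` measurable and non-empty, `μ` s-finite), `F ∈ L¹(μ_Q)` of shape (F) along `E`:
`F(E⁻¹(x, y)) = g(x) · ∏ᶠ_i φ_i(y_i)` with `φ_i ≡ 1` on `K_i`.  THEN the tensor `(x, y) ↦ g(x) · ∏ᶠ_i φ_i(y_i)` is `μ ⊗ ∏'ν`-integrable and
`∫_Q F dμ_Q = (∫ g dμ) · ∏'_i ∫ φ_i dν_i` (§1 + ★ Φ3c `integral_mul_finprod_eq_mul_tprod`). [cite: CasselsFrohlichANT1967, Ch. XV (Tate) §3.3 Thm. 3.3.1] [cite: BorelJacquet1979, §4.1] -/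
theorem integral_eq_mul_tprod_of_map_eq (μQ : Measure Q) (μ : Measure X) [SFinite μ]
    (hKne : ∀ i, (K i).Nonempty) (hKm : ∀ i, MeasurableSet (K i)) (hK1 : ∀ i, ν i (K i) = 1)
    (E : Q ≃ᵐ X × (Πʳ i, [G i, K i])) (hmap : Measure.map E μQ = μ.prod (rpMeasure K ν ∅))
    {F : Q → ℂ} (hFi : Integrable F μQ) (g : X → ℂ) (φ : ∀ i, G i → ℂ) (hφK : ∀ i, ∀ k ∈ K i, φ i k = 1)
    (hF : ∀ (x : X) (y : Πʳ i, [G i, K i]), F (E.symm (x, y)) = g x * ∏ᶠ i, φ i (y i)) :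
    Integrable (fun z : X × (Πʳ i, [G i, K i]) => g z.1 * ∏ᶠ i, φ i (z.2 i)) (μ.prod (rpMeasure K ν ∅)) ∧
      ∫ q, F q ∂μQ = (∫ x, g x ∂μ) * ∏' i, ∫ y, φ i y ∂(ν i) := by
  have hfun : (fun z : X × (Πʳ i, [G i, K i]) => F (E.symm z)) = fun z => g z.1 * ∏ᶠ i, φ i (z.2 i) := by
    funext z
    exact hF z.1 z.2
  have hint : Integrable (fun z : X × (Πʳ i, [G i, K i]) => g z.1 * ∏ᶠ i, φ i (z.2 i)) (μ.prod (rpMeasure K ν ∅)) := by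
    rw [← hfun]
    exact (integrable_comp_symm_of_map_eq K μQ _ E hmap).2 hFi
  refine ⟨hint, ?_⟩
  rw [integral_eq_integral_comp_symm_of_map_eq K μQ _ E hmap F, hfun]
  exact integral_mul_finprod_eq_mul_tprod K ν μ hKne hKm hK1 g φ hφK hint

/-- **CONVERGENCE OF THE EULER PRODUCT along the splitting**: in the situation of `integral_eq_mul_tprod_of_map_eq`, if `g` is NOT a.e. zero then
`y ↦ ∏ᶠ_i φ_i(y_i)` is `∏'ν`-integrable and `∏_i ∫ φ_i dν_i` CONVERGES to its integral as a `HasProd` over the finite sets of indices (★ Φ3c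
`integrable_finprod_of_integrable_mul` + ★ Tate 3.3.1 `hasProd_integral_of_integrable_finprod`) — the product of the «local constants» is convergent as soon as the
global integrand is integrable. [cite: CasselsFrohlichANT1967, Ch. XV (Tate) §3.3 Thm. 3.3.1] -/
theorem hasProd_integral_of_map_eq (μQ : Measure Q) (μ : Measure X) [SFinite μ]
    (hKne : ∀ i, (K i).Nonempty) (hKm : ∀ i, MeasurableSet (K i)) (hK1 : ∀ i, ν i (K i) = 1)
    (E : Q ≃ᵐ X × (Πʳ i, [G i, K i])) (hmap : Measure.map E μQ = μ.prod (rpMeasure K ν ∅))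
    {F : Q → ℂ} (hFi : Integrable F μQ) (g : X → ℂ) (hg : ¬ g =ᵐ[μ] 0) (φ : ∀ i, G i → ℂ) (hφK : ∀ i, ∀ k ∈ K i, φ i k = 1)
    (hF : ∀ (x : X) (y : Πʳ i, [G i, K i]), F (E.symm (x, y)) = g x * ∏ᶠ i, φ i (y i)) :
    Integrable (fun y : Πʳ i, [G i, K i] => ∏ᶠ i, φ i (y i)) (rpMeasure K ν ∅) ∧
      HasProd (fun i => ∫ y, φ i y ∂(ν i)) (∫ y, ∏ᶠ i, φ i (y i) ∂(rpMeasure K ν ∅)) := by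
  have hint := (integral_eq_mul_tprod_of_map_eq K ν μQ μ hKne hKm hK1 E hmap hFi g φ hφK hF).1
  have hΦ := integrable_finprod_of_integrable_mul K ν μ hKm hK1 g φ hint hg
  exact ⟨hΦ, hasProd_integral_of_integrable_finprod K ν hKne hKm hK1 φ hφK hΦ⟩

omit [Countable ι] [∀ i, SigmaFinite (ν i)] in
/-- **the factorizable integrand is integrable on `Q` iff its tensor is integrable on the product** (§1 + shape (F)) — the direction the Klingen fibre uses to IMPORT
integrability from ★ F4-2b and the direction a consumer uses to EXPORT it. [cite: BorelJacquet1979, §4.1] -/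
theorem integrable_iff_of_map_eq (μQ : Measure Q) (μ : Measure X)
    (E : Q ≃ᵐ X × (Πʳ i, [G i, K i])) (hmap : Measure.map E μQ = μ.prod (rpMeasure K ν ∅))
    {F : Q → ℂ} (g : X → ℂ) (φ : ∀ i, G i → ℂ)
    (hF : ∀ (x : X) (y : Πʳ i, [G i, K i]), F (E.symm (x, y)) = g x * ∏ᶠ i, φ i (y i)) :
    Integrable F μQ ↔ Integrable (fun z : X × (Πʳ i, [G i, K i]) => g z.1 * ∏ᶠ i, φ i (z.2 i)) (μ.prod (rpMeasure K ν ∅)) := by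
  have hfun : (fun z : X × (Πʳ i, [G i, K i]) => F (E.symm z)) = fun z => g z.1 * ∏ᶠ i, φ i (z.2 i) := by
    funext z
    exact hF z.1 z.2
  rw [← hfun]
  exact (integrable_comp_symm_of_map_eq K μQ _ E hmap).symm

/-- **THE HEAD with a measure-preserving splitting**: the same Euler product when the splitting is handed over as `MeasurePreserving E μ_Q (μ ⊗ ∏'ν)` (the form
★ Φ3b∕Φ3c's pins produce after `⟨E.measurable, hmap⟩`). [cite: CasselsFrohlichANT1967, Ch. XV (Tate) §3.3 Thm. 3.3.1] -/
theorem integral_eq_mul_tprod_of_map_eq' (μQ : Measure Q) (μ : Measure X) [SFinite μ]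
    (hKne : ∀ i, (K i).Nonempty) (hKm : ∀ i, MeasurableSet (K i)) (hK1 : ∀ i, ν i (K i) = 1)
    (E : Q ≃ᵐ X × (Πʳ i, [G i, K i])) (hE : MeasurePreserving E μQ (μ.prod (rpMeasure K ν ∅)))
    {F : Q → ℂ} (hFi : Integrable F μQ) (g : X → ℂ) (φ : ∀ i, G i → ℂ) (hφK : ∀ i, ∀ k ∈ K i, φ i k = 1)
    (hF : ∀ (x : X) (y : Πʳ i, [G i, K i]), F (E.symm (x, y)) = g x * ∏ᶠ i, φ i (y i)) :
    ∫ q, F q ∂μQ = (∫ x, g x ∂μ) * ∏' i, ∫ y, φ i y ∂(ν i) :=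
  (integral_eq_mul_tprod_of_map_eq K ν μQ μ hKne hKm hK1 E hE.map_eq hFi g φ hφK hF).2

end Summit.HodgeConjecture.HodgeConjecture.Cruxes.HLiu418.K2LiuKlingenInnerSectionEuler

end
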